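import Summits.AtomisticToContinuum.BoseEinsteinCondensation.Theorems.BECCutLineWeakDisorderDefs
import Literature.MathematicalPhysics.QuantumManyBody.SwapPurity
import HarnessLib

/-!
# Route `BECCutLineWeakDisorder`, crux `TwoReplicaTransienceBound` (stmt-AtomisticToContinuum-9687),
# line `SketchIdeator1` (tracer decoupling): stub `stub_decoupling`

Support file (`--supports stmt-AtomisticToContinuum-9687`): proves the registered stub
`stub_decoupling : Goal.stub_decoupling` (statement `Decoupling` of
`Theorems/BECCutLineWeakDisorderDefs.lean`): the passive-tracer decoupling inequality
`∫ₓ Z_T(x::Y)² dx ≤ Z_n(Y) · ∫ fkWeight v L T Y ωb (∫ₓ tracer(x,Y,ωb)² dx) dW_n(ωb)`,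
given the factorisation `Z_T(x::Y) = ∫ fkWeight(Y,ωb) tracer(x,Y,ωb) dW_n(ωb)` (hypothesis 1) and the
joint measurability of `(x, ωb) ↦ tracer v L T x Y ωb` (hypothesis 2).

Proof (pattern of `fkNormSq_le`, `GroundStateFeynmanKacCutLine.lean`): pointwise in `x`,
Cauchy–Schwarz (`ENNReal.lintegral_mul_le_Lp_mul_Lq` with `f = 1`, `p = q = 2`) in the finite
sub-probability measure `fkPathMeasure v L T Y = fkWeight v L T Y · wienerPaths n`, whose total mass is
`Z_n(Y) = fkPartition v L T Y` (`fkPathMeasure_univ`), gives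
`(∫ w g(x,·))² ≤ Z_n(Y) · ∫ w g(x,·)²`; then integrate in `x`, pull out the finite constant `Z_n(Y)`,
swap the two lower Lebesgue integrals (Tonelli, `lintegral_lintegral_swap`, joint measurability from
hypothesis 2 and `measurable_fkWeight`) and pull the weight out of the inner `x`-integral.
-/

noncomputable section

namespace Summit.AtomisticToContinuum.BoseEinsteinCondensation.Cruxes.TwoReplicaTransienceBound.TracerDecoupling

open MeasureTheory Filter Set
open scoped ENNReal NNReal Topology BigOperators
open Literature.MathematicalPhysics.QuantumManyBody.BoseGas
open Literature.Probability.Process (preWienerMeasure brownian measurable_brownian continuous_brownian)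

/-- The Feynman–Kac weight is finite (it is at most `1`). -/
theorem fkWeight_ne_top {N : ℕ} (v : ℝ → ℝ≥0∞) (L T : ℝ) (X : Config N) (ω : PathSpace N) :
    fkWeight v L T X ω ≠ ⊤ :=
  ne_top_of_le_ne_top ENNReal.one_ne_top (fkWeight_le_one v L T X ω)

/-- Square of a product of square roots in `[0, ∞]`: `(a^{1/2} b^{1/2})² = a b`. -/
theorem sq_rpow_half_mul_rpow_half (a b : ℝ≥0∞) :
    (a ^ (1 / (2 : ℝ)) * b ^ (1 / (2 : ℝ))) ^ 2 = a * b := by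
  rw [mul_pow, ← ENNReal.rpow_two, ← ENNReal.rpow_mul, ← ENNReal.rpow_two, ← ENNReal.rpow_mul]
  norm_num

/-- **Weighted Cauchy–Schwarz in the killed path measure**: for measurable `v` and measurable
`g : PathSpace N → [0, ∞]`,
`(∫ fkWeight v L T X ω · g ω dW_N)² ≤ Z_T(X) · ∫ fkWeight v L T X ω · g ω² dW_N`
(Hölder with exponents `2, 2` and `f = 1` in the finite measure `fkPathMeasure v L T X`, total mass
`fkPartition v L T X`). -/
theorem lintegral_fkWeight_mul_sq_le {N : ℕ} {v : ℝ → ℝ≥0∞} (hv : Measurable v) (L T : ℝ)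
    (X : Config N) {g : PathSpace N → ℝ≥0∞} (hg : Measurable g) :
    (∫⁻ ω, fkWeight v L T X ω * g ω ∂wienerPaths N) ^ 2 ≤
      fkPartition v L T X * ∫⁻ ω, fkWeight v L T X ω * g ω ^ 2 ∂wienerPaths N := by
  have h1 := ENNReal.lintegral_mul_le_Lp_mul_Lq (fkPathMeasure v L T X)
    Real.HolderConjugate.two_two (f := fun _ => 1) (g := g) aemeasurable_const hg.aemeasurable
  simp only [Pi.mul_apply, one_mul, ENNReal.one_rpow, lintegral_const, fkPathMeasure_univ] at h1
  rw [← lintegral_fkPathMeasure hv, ← lintegral_fkPathMeasure hv]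
  calc (∫⁻ ω, g ω ∂fkPathMeasure v L T X) ^ 2
      ≤ (fkPartition v L T X ^ (1 / (2 : ℝ)) *
          (∫⁻ ω, g ω ^ (2 : ℝ) ∂fkPathMeasure v L T X) ^ (1 / (2 : ℝ))) ^ 2 :=
        pow_le_pow_left' h1 2
    _ = fkPartition v L T X * ∫⁻ ω, g ω ^ (2 : ℝ) ∂fkPathMeasure v L T X :=
        sq_rpow_half_mul_rpow_half _ _
    _ = fkPartition v L T X * ∫⁻ ω, g ω ^ 2 ∂fkPathMeasure v L T X := by
        simp_rw [ENNReal.rpow_two]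

/-- Registered stub `stub_decoupling` of line SketchIdeator1 (statement `Decoupling`):
`∫ₓ Z_T(x::Y)² ≤ Z_n(Y) · ∫ fkWeight v L T Y ωb (∫ₓ tracer(x,Y,ωb)²) dW_n(ωb)` — pointwise weighted
Cauchy–Schwarz in `ωb` (`lintegral_fkWeight_mul_sq_le`, through the factorisation hypothesis), then
Tonelli in `(x, ωb)` (through the joint-measurability hypothesis). -/
theorem stub_decoupling : Goal.stub_decoupling := by
  intro n v hv L T Y hF hM
  -- pointwise in `x`: `Z_T(x::Y)² = (∫ w g(x,·))² ≤ Z_n(Y) ∫ w g(x,·)²`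
  have hpt : ∀ x : Space, fkPartition v L T (Matrix.vecCons x Y) ^ 2 ≤
      fkPartition v L T Y *
        ∫⁻ ωb, fkWeight v L T Y ωb * tracer v L T x Y ωb ^ 2 ∂wienerPaths n := fun x => by
    -- measurability of the section `ωb ↦ tracer v L T x Y ωb` (hypothesis 2 along `ωb ↦ (x, ωb)`)
    have hgx := hM.fun_comp (measurable_prodMk_left (x := x))
    dsimp only at hgx
    rw [hF x]
    exact lintegral_fkWeight_mul_sq_le hv L T Y hgx
  -- joint measurability of the Tonelli integrand `(x, ωb) ↦ w(ωb) g(x, ωb)²`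
  have hm : Measurable (Function.uncurry fun (x : Space) (ωb : PathSpace n) =>
      fkWeight v L T Y ωb * tracer v L T x Y ωb ^ 2) :=
    ((measurable_fkWeight hv L T Y).fun_comp measurable_snd).mul (hM.pow_const 2)
  calc ∫⁻ x, fkPartition v L T (Matrix.vecCons x Y) ^ 2
      ≤ ∫⁻ x, fkPartition v L T Y *
          ∫⁻ ωb, fkWeight v L T Y ωb * tracer v L T x Y ωb ^ 2 ∂wienerPaths n :=
        lintegral_mono hpt
    _ = fkPartition v L T Y *
          ∫⁻ x, ∫⁻ ωb, fkWeight v L T Y ωb * tracer v L T x Y ωb ^ 2 ∂wienerPaths n :=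
        lintegral_const_mul' _ _ (fkPartition_ne_top v L T Y)
    _ = fkPartition v L T Y *
          ∫⁻ ωb, ∫⁻ x, fkWeight v L T Y ωb * tracer v L T x Y ωb ^ 2 ∂volume ∂wienerPaths n := by
        rw [lintegral_lintegral_swap hm.aemeasurable]
    _ = fkPartition v L T Y *
          ∫⁻ ωb, fkWeight v L T Y ωb * (∫⁻ x, tracer v L T x Y ωb ^ 2) ∂wienerPaths n := by
        congr 1
        exact lintegral_congr fun ωb => lintegral_const_mul' _ _ (fkWeight_ne_top v L T Y ωb)

end Summit.AtomisticToContinuum.BoseEinsteinCondensation.Cruxes.TwoReplicaTransienceBound.TracerDecoupling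

end
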